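import Literature.Claims.NS.Kyritsis2017
import Literature.Analysis.FluidPDE.BaeChoeTwoVelocityComponentsCriterion
import Literature.Analysis.FluidPDE.NSSuitableESSPressureProofs
import Summits.NavierStokesRegularity.NavierStokesRegularity.Theorems.SoloSalvageKyritsis2021
import HarnessLib

/-!
# Solo salvage for claim C03c `Kyritsis2017` (cell `ns-claims`, D-0090): the `L^∞`-velocity
# continuation criterion (Step 3) kernel-discharged, and the Navier–Stokes half of the printed
# CONDITIONAL theorem proved outright

Claim skeleton: `Literature/Claims/NS/Kyritsis2017.lean` (typist `ns-claims-typist-3`, p463635): the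
author's FIRST argument (J. Sci. Res. Stud. 4(11) (2017) 304–317), Prop. 5.2 p. 315 = regularity
UNDER THE ADDED HYPOTHESIS «conservation of particles as local structure» (Def. 5.1 p. 314), typed as
`ClaimedTheorem` (Euler and Navier–Stokes) with Navier–Stokes half `ClaimedTheoremNS`; not a Clay
statement (no `clay_of_claimed`). The skeleton already proves `step2_holds` (Prop. 4.8 from BKM),
`step4_of_step1` (Prop. 5.1, 1st proof: conservation of particles + energy inequality ⇒ bounded
velocity) and `claimNS_of_known : Step_1 → Step_3 → ClaimedTheoremNS`.

This file (seat `ns-claims-salvage-p3`) supplies the two classical inputs for `ν > 0`: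

* `step3_holds : Step_3` — PROP 4.9 (p. 313, «Fefferman 2006»; the `L^∞`-velocity continuation
  criterion): a class solution on `[0,T*)`, `ν > 0`, with bounded velocity continues in the
  Beale–Kato–Majda class past `T*`. Kernel route: bounded velocity ⇒ every velocity COMPONENT lies in
  `L^∞_t L^∞_x` (`memLqLp_top_of_ae_slice_bound`) ⇒ the tree's Bae–Choe two-velocity-components
  criterion at the endpoint `(α, γ) = (∞, ∞)`
  (`baeChoe_two_velocity_components_criterion_top_of_le`, Bae–Choe 2007 / Serrin-class continuation,
  proved in the tree) ⇒ `HasSobolevExtensionPast`. (The compact-support hypothesis of `Step_3` is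
  not used.) Original source of the criterion: Serrin 1962 / the `L^∞` case of the
  Prodi–Serrin–Ladyzhenskaya class; Fefferman's Clay text p. 2.
* `step4_pos` — PROP 5.1 (1st proof, p. 315) for `ν > 0` WITHOUT assuming `Step_1`: the typist's
  quantitative argument `step4_of_step1` re-run with the kernel energy inequality
  `Kyritsis2021Salvage.energy_antitone_of_isLocalClassSolution` (p464800) in place of `Step_1`
  (= `Kyritsis2021.Step_2`, whose `ν = 0` clause is not kernel-available).
* `claimedTheoremNS_holds : ClaimedTheoremNS` — hence the Navier–Stokes half of the printed
  conditional Proposition 5.2 HOLDS outright in the kernel (it is a true conditional-regularity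
  statement; the adjudication question for C03c is only whether it is a Clay statement — it is not:
  the hypothesis `ConservationOfParticles u T` is a condition on the solution).

Solo lane (`Theorems/SoloSalvage<Slug>.lean`, no item).

WHAT THIS IS NOT: not a claim about NS regularity or blow-up; not a claim about any author beyond the
typed locator.
-/

noncomputable section

-- The summit-side namespace repeats the summit name by design (D-0017 layout); tree precedent
-- `SoloSalvageRamm2024.lean`.
set_option linter.dupNamespace false

open MeasureTheory Set Filter
open scoped RealInnerProductSpace ENNReal Topology ContDiff

namespace Summit.NavierStokesRegularity.NavierStokesRegularity.Theorems.Kyritsis2017Salvage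

open Literature.Analysis.FluidPDE Literature.Claims.NS.Kyritsis2021 Literature.Claims.NS.Kyritsis2017
open Summit.NavierStokesRegularity.NavierStokesRegularity.Theorems.Kyritsis2021Salvage

/-! ## Step 3 (Prop 4.9, p. 313): bounded velocity ⇒ continuation in the class, `ν > 0` -/

/-- A bounded velocity field on `[0,T) × ℝ³` with continuous slices has every component in
`L^∞_t L^∞_x` on `(0,T)` (the tree's mixed-norm class `MemLqLp ∞ ∞`). -/
theorem memLqLp_top_top_component {T M : ℝ}
    {u : ℝ → EuclideanSpace ℝ (Fin 3) → EuclideanSpace ℝ (Fin 3)}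
    (hcont : ∀ t ∈ Ico 0 T, Continuous (u t)) (hM : ∀ t ∈ Ico 0 T, ∀ x, ‖u t x‖ ≤ M) (j : Fin 3) :
    MemLqLp ∞ ∞ (fun t x => u t x j) (Ioo 0 T) := by
  refine memLqLp_top_of_ae_slice_bound (C := ENNReal.ofReal M) ENNReal.ofReal_ne_top ?_
  refine (ae_restrict_iff' measurableSet_Ioo).2 (ae_of_all _ fun t ht => ?_)
  have htI : t ∈ Ico 0 T := ⟨ht.1.le, ht.2⟩
  have hmeas : AEStronglyMeasurable (fun x => u t x j) volume :=
    (((EuclideanSpace.proj j : EuclideanSpace ℝ (Fin 3) →L[ℝ] ℝ).continuous).comp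
      (hcont t htI)).aestronglyMeasurable
  have hbound : ∀ᵐ x ∂(volume : Measure (EuclideanSpace ℝ (Fin 3))), ‖u t x j‖ ≤ M :=
    ae_of_all _ fun x => (PiLp.norm_apply_le (u t x) j).trans (hM t htI x)
  refine ⟨memLp_top_of_bound hmeas M hbound, ?_⟩
  rw [eLpNorm_exponent_top]
  exact eLpNormEssSup_le_of_ae_bound hbound

/-- **`Step_3` holds** (PROP 4.9, p. 313, the `L^∞`-velocity continuation criterion, `ν > 0`):
every class solution on `[0,T*)` whose velocity is bounded on `[0,T*) × ℝ³` continues in the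
Beale–Kato–Majda class past `T*` — by the tree's two-velocity-components criterion at the
`L^∞_t L^∞_x` endpoint (all three components are bounded, so any two are). The compact-support
hypothesis is not used. -/
theorem step3_holds : Literature.Claims.NS.Kyritsis2017.Step_3 := by
  intro ν hν T hT u p hsol _ hbdd
  obtain ⟨M, hM⟩ := hbdd
  have hcont : ∀ t ∈ Ico 0 T, Continuous (u t) := fun t ht =>
    (hsol.1.contDiff_velocity ht).continuous
  exact baeChoe_two_velocity_components_criterion_top_of_le hν hT hsol.1 hsol.2 (α := ⊤) le_top 0
    fun j _ => memLqLp_top_top_component hcont hM j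

/-! ## Step 4 (Prop 5.1, 1st proof, p. 315) at positive viscosity, without assuming Step 1 -/

/-- Bookkeeping: the `n = 0` Sobolev quantity of the BKM class is the `L²` energy integrand. -/
private theorem lintegral_enorm_iteratedFDeriv_zero
    (f : EuclideanSpace ℝ (Fin 3) → EuclideanSpace ℝ (Fin 3)) :
    (∫⁻ x, ‖iteratedFDeriv ℝ 0 f x‖ₑ ^ 2) = ∫⁻ x, ‖f x‖ₑ ^ 2 := by
  refine lintegral_congr fun x => ?_
  rw [← ofReal_norm, norm_iteratedFDeriv_zero, ofReal_norm]

/-- **PROP 5.1 (1st proof, p. 315) for `ν > 0`, unconditionally**: under «conservation of particles»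
the velocity of a class solution is bounded uniformly on `[0,T)` — the typist's quantitative
argument `Kyritsis2017.step4_of_step1` (particle range `B(c,r)` on which `|u(t,·)| ≥ |u(t,x)| − δu`;
`|B(r)|(|u(t,x)| − δu)₊² ≤ ∫|u(t)|² ≤ 2E(0)`) with the energy inequality supplied by the kernel
theorem `Kyritsis2021Salvage.energy_antitone_of_isLocalClassSolution` instead of `Step_1`. -/
theorem step4_pos {ν : ℝ} (hν : 0 < ν) {T : ℝ} (hT : 0 < T)
    {u : ℝ → EuclideanSpace ℝ (Fin 3) → EuclideanSpace ℝ (Fin 3)}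
    {p : ℝ → EuclideanSpace ℝ (Fin 3) → ℝ} (hsol : IsLocalClassSolution ν T u p)
    (hcons : ConservationOfParticles u T) :
    ∃ M : ℝ, ∀ t ∈ Ico 0 T, ∀ x : EuclideanSpace ℝ (Fin 3), ‖u t x‖ ≤ M := by
  obtain ⟨r, hr, δu, _, hosc⟩ := hcons.oscillation
  -- the initial energy integral K = ∫|u(0)|² is finite (class solution, n = 0)
  set K : ℝ≥0∞ := ∫⁻ y, ‖u 0 y‖ₑ ^ 2 with hK
  have hKtop : K < ⊤ := by
    obtain ⟨C, hC⟩ := hsol.2 (T / 2) (by linarith) 0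
    have hle : K ≤ C := by
      rw [hK, ← lintegral_enorm_iteratedFDeriv_zero]
      exact hC 0 ⟨le_rfl, by linarith⟩
    exact hle.trans_lt ENNReal.coe_lt_top
  -- the volume of a particle range
  set V : ℝ≥0∞ := volume (Metric.ball (0 : EuclideanSpace ℝ (Fin 3)) r) with hV
  have hV0 : V ≠ 0 := (Metric.measure_ball_pos volume (0 : EuclideanSpace ℝ (Fin 3)) hr).ne'
  have hVtop : V ≠ ⊤ := measure_ball_lt_top.ne
  refine ⟨δu + Real.sqrt ((K / V).toReal), fun t ht x => ?_⟩
  obtain ⟨c, _, hball⟩ := hosc t ht x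
  -- energy at time t is at most the initial energy (kernel energy inequality, ν > 0)
  have hEt : (∫⁻ y, ‖u t y‖ₑ ^ 2) ≤ K := by
    have hmono := energy_antitone_of_isLocalClassSolution hν hsol (s := 0) (t := t) ⟨le_rfl, hT⟩ ht ht.1
    unfold energy at hmono
    exact (ENNReal.mul_le_mul_iff_right (by simp) (by simp)).mp hmono
  set a : ℝ := ‖u t x‖ - δu with ha
  rcases le_or_gt a 0 with ha0 | ha0
  · have : ‖u t x‖ ≤ δu := by linarith
    exact this.trans (le_add_of_nonneg_right (Real.sqrt_nonneg _))
  · have hlow : ∀ y ∈ Metric.ball c r, ENNReal.ofReal a ≤ ‖u t y‖ₑ := fun y hy => by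
      rw [← ofReal_norm]
      apply ENNReal.ofReal_le_ofReal
      have h := hball y hy
      have : ‖u t x‖ ≤ ‖u t x - u t y‖ + ‖u t y‖ := by
        simpa using norm_add_le (u t x - u t y) (u t y)
      linarith
    have hball_int : ENNReal.ofReal a ^ 2 * V ≤ ∫⁻ y in Metric.ball c r, ‖u t y‖ₑ ^ 2 := by
      rw [hV, ← Measure.addHaar_ball_center volume c r, ← setLIntegral_const]
      refine setLIntegral_mono' Metric.isOpen_ball.measurableSet fun y hy => ?_
      gcongr
      exact hlow y hy
    have hchain : ENNReal.ofReal a ^ 2 * V ≤ K :=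
      hball_int.trans ((setLIntegral_le_lintegral _ _).trans hEt)
    have hdiv : ENNReal.ofReal a ^ 2 ≤ K / V :=
      (ENNReal.le_div_iff_mul_le (Or.inl hV0) (Or.inl hVtop)).mpr hchain
    have hKV : K / V ≠ ⊤ := (ENNReal.div_lt_top hKtop.ne hV0).ne
    have hsq : a ^ 2 ≤ (K / V).toReal := by
      rw [← ENNReal.ofReal_pow ha0.le] at hdiv
      exact (ENNReal.ofReal_le_iff_le_toReal hKV).mp hdiv
    have hle : a ≤ Real.sqrt ((K / V).toReal) := by
      rw [← Real.sqrt_sq ha0.le]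
      exact Real.sqrt_le_sqrt hsq
    rw [ha] at hle
    linarith

/-! ## The Navier–Stokes half of the printed conditional theorem holds -/

/-- **PROPOSITION 5.2 (p. 315), Navier–Stokes half, AS PRINTED (a conditional statement) — TRUE in
the kernel:** for `ν > 0`, every class solution on `[0,T*)` with compactly supported (connected)
datum that «conserves particles as a local structure» on `[0,T*)` (Def. 5.1, p. 314) continues in
the class past `T*`. Proof: `step4_pos` (bounded velocity) and `step3_holds` (the `L^∞` criterion).
This does not make it a Clay statement: the hypothesis `ConservationOfParticles u T` constrains the
SOLUTION (the skeleton has, rightly, no `clay_of_claimed`). -/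
theorem claimedTheoremNS_holds : ClaimedTheoremNS := by
  intro ν hν T hT u p hsol hcpt _ hcons
  exact step3_holds ν hν T hT u p hsol hcpt (step4_pos hν hT hsol hcons)

/-- The same through the skeleton's own composition `claimNS_of_known`, for the record: with
`Step_3` discharged here, `ClaimedTheoremNS` needs only `Step_1` (= `Kyritsis2021.Step_2`, the
energy inequality for all `ν ≥ 0`; its `ν > 0` clause is `Kyritsis2021Salvage.step2_of_pos_viscosity`). -/
theorem claimedTheoremNS_of_step1 (h1 : Literature.Claims.NS.Kyritsis2017.Step_1) : ClaimedTheoremNS :=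
  claimNS_of_known h1 step3_holds

end Summit.NavierStokesRegularity.NavierStokesRegularity.Theorems.Kyritsis2017Salvage
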